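import Literature.NumberTheory.Automorphic.ModularLambdaDeriv
import HarnessLib

/-!
# The modular `λ`-function on the imaginary axis, and the series `q dλ/dq = Σ n aₙ qⁿ`

Eighth file on the modular `λ`-function (`ModularLambda.lean`: `λ = θ₂⁴/θ₃⁴`;
`ModularLambdaQExpansion.lean` / `ModularLambdaNome.lean`: `λ(τ) = Σ aₙ qⁿ`, `q = e^{πiτ}`,
`aₙ = 16·(qExpansion 2 (λ/16))ₙ`, `λ = 16 Λ(q)` with `Λ` holomorphic on the unit disc;
`ModularLambdaDeriv.lean`: `λ' = πi λ θ₄⁴`). We record the classical behaviour of `λ` on the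
positive imaginary axis `τ = iy`, in the form used in §4.4 of A. Javanpeykar, *Polynomial bounds for
Arakelov invariants of Belyi curves*, Algebra & Number Theory **8** (2014), arXiv:1403.6404
([Javanpeykar2014], §4.4 "The modular lambda function": "`λ(i∞) = 0`, … The restriction of `λ` to
the imaginary axis `{iy : y > 0}` in `ℍ` induces a homeomorphism, also denoted by `λ`, from
`{iy : y > 0}` to the open interval `(0,1)` in `ℝ`", and Lemma 4.4.1, whose left-hand side is the
series `Σ n aₙ qⁿ(iy) = q dλ/dq`):

* `hasDerivAt_modularLambda_I_mul_re` — **`(d/dy) λ(iy) = −π λ(iy) θ₄(iy)⁴ = −π θ₂⁴θ₄⁴/θ₃⁴(iy)`**,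
  and `norm_deriv_modularLambda_I_mul` — `|λ'(iy)| = π θ₂⁴θ₄⁴/θ₃⁴ (iy)`;
* `strictAntiOn_modularLambda_I_mul_re` — `y ↦ λ(iy)` is strictly decreasing on `(0, ∞)`;
  `tendsto_modularLambda_I_mul_re_atTop` (`→ 0` at `y → ∞`),
  `tendsto_modularLambda_I_mul_re_nhdsGT_zero` (`→ 1` at `y → 0⁺`, by `λ(i/y) = 1 − λ(iy)`);
* `existsUnique_modularLambda_I_mul_eq` — **every `a ∈ (0, 1)` is `λ(iy)` for a unique `y > 0`**
  (Javanpeykar's homeomorphism `λ : i(0, ∞) → (0, 1)`; he writes the inverse as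
  `λ⁻¹(α) = i M(1, √α)/M(1, √(1 − α))` — for that AGM form see the tree's
  `Literature.Analysis.SpecialFunctions.JacobiThetaAGM`);
* `hasSum_natCast_mul_coeff_mul_pow`, `hasSum_natCast_mul_coeff_mul_exp` — **termwise
  differentiation of the `q`-expansion**: for `|q| < 1`, `Σ n aₙ qⁿ = 16 q Λ'(q)`, and for
  `q = e^{πiτ}`, `Im τ > 0`: `Σ n aₙ qⁿ = λ'(τ)/(πi)` (`= λ(τ) θ₄(τ)⁴`) — the identity
  "`Σ n aₙ qⁿ = q dλ/dq`" opening the proof of [Javanpeykar2014, Lemma 4.4.1].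

Everything is proved (Mathlib's analytic-function and `q`-expansion API, the tree's theta cluster);
no definition and no named fact is introduced. `λ(i) = 1/2` is already
`ModularLambda.modularLambda_I` (`ModularLambdaSurjective.lean`), and `λ(iy) ∈ (0, 1)` is
`modularLambda_I_mul` (`ModularLambda.lean`). The quantitative half of Javanpeykar's §4.4
(Lemma 4.4.1: `|q dλ/dq| ≥ 3/20` for `4/5 ≤ y ≤ 1`, and `λ(iy) ∈ [1/2, 2/3] ⇒ y ∈ [4/5, 1]`) is the
sequel `ModularLambdaQDerivLowerBound.lean`.

## References

* A. Javanpeykar, *Polynomial bounds for Arakelov invariants of Belyi curves* (with an appendix by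
  P. Bruin), Algebra & Number Theory 8 (2014), no. 1, 89–140, doi:10.2140/ant.2014.8.89,
  arXiv:1403.6404: §4.4, Lemma 4.4.1. [Javanpeykar2014]
* E. T. Whittaker, G. N. Watson, *A Course of Modern Analysis*, 4th ed. (1927), §21.7–21.71.
-/

noncomputable section

open Complex Real Filter Topology

open scoped Real

namespace Literature.NumberTheory.Automorphic

namespace ModularLambda

open Literature.NumberTheory.EllipticCurves.JacobiThetaNull

variable {y : ℝ}

/-! ### Values and derivative on the axis -/

/-- `λ(iy)` is real: `Re λ(iy) = θ₂(iy)⁴/θ₃(iy)⁴` (and `λ(iy) = Re λ(iy)`, `modularLambda_I_mul`).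
[folklore] -/
theorem modularLambda_I_mul_re (hy : 0 < y) :
    (modularLambda (I * y)).re = (theta2 (I * y)).re ^ 4 / (theta3 (I * y)).re ^ 4 := by
  rw [(modularLambda_I_mul hy).1, ofReal_re]

/-- **`λ(iy) θ₄(iy)⁴` is the positive real number `θ₂⁴θ₄⁴/θ₃⁴ (iy)`.** [folklore] -/
theorem modularLambda_mul_theta4_pow_four_I_mul (hy : 0 < y) :
    modularLambda (I * y) * theta4 (I * y) ^ 4 =
      (((theta2 (I * y)).re ^ 4 * (theta4 (I * y)).re ^ 4 / (theta3 (I * y)).re ^ 4 : ℝ) : ℂ) := by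
  rw [(modularLambda_I_mul hy).1]
  conv_lhs => rw [theta4_I_mul_eq_re hy]
  push_cast
  ring

/-- `θ₂⁴θ₄⁴/θ₃⁴ (iy) > 0`. [folklore] -/
theorem thetaQuot_pos (hy : 0 < y) :
    0 < (theta2 (I * y)).re ^ 4 * (theta4 (I * y)).re ^ 4 / (theta3 (I * y)).re ^ 4 :=
  div_pos (mul_pos (pow_pos (theta2_I_mul_re_pos hy) 4) (pow_pos (theta4_I_mul_re_pos hy) 4))
    (pow_pos (theta3_I_mul_re_pos hy) 4)

/-- **`|dλ/dτ (iy)| = π λ(iy) θ₄(iy)⁴ = π θ₂⁴θ₄⁴/θ₃⁴ (iy)`** (from `λ' = πi λ θ₄⁴`,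
`deriv_modularLambda_eq'`). [folklore] -/
theorem norm_deriv_modularLambda_I_mul (hy : 0 < y) :
    ‖deriv modularLambda (I * y)‖ =
      π * ((theta2 (I * y)).re ^ 4 * (theta4 (I * y)).re ^ 4 / (theta3 (I * y)).re ^ 4) := by
  rw [deriv_modularLambda_eq' (im_I_mul_pos hy), mul_assoc (↑π * I),
    modularLambda_mul_theta4_pow_four_I_mul hy, norm_mul, norm_mul, Complex.norm_real,
    Complex.norm_I, mul_one, Complex.norm_real, Real.norm_of_nonneg pi_pos.le,
    Real.norm_of_nonneg (thetaQuot_pos hy).le]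

/-- **`(d/dy) λ(iy) = -π λ(iy) θ₄(iy)⁴ = -π θ₂⁴θ₄⁴/θ₃⁴ (iy)`** (real form of `λ' = πi λ θ₄⁴`
along `τ = iy`). [folklore] -/
theorem hasDerivAt_modularLambda_I_mul_re (hy : 0 < y) :
    HasDerivAt (fun t : ℝ ↦ (modularLambda (I * t)).re)
      (-(π * ((theta2 (I * y)).re ^ 4 * (theta4 (I * y)).re ^ 4 / (theta3 (I * y)).re ^ 4))) y := by
  have him : 0 < im (I * y) := im_I_mul_pos hy
  have h1 : HasDerivAt (fun w : ℂ ↦ I * w) I (y : ℂ) := by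
    simpa using (hasDerivAt_id (y : ℂ)).const_mul I
  have h2 : HasDerivAt (fun w : ℂ ↦ modularLambda (I * w)) (deriv modularLambda (I * y) * I)
      (y : ℂ) :=
    (hasDerivAt_modularLambda him).comp (y : ℂ) h1
  convert h2.real_of_complex using 1
  rw [deriv_modularLambda_eq' him, mul_assoc (↑π * I), modularLambda_mul_theta4_pow_four_I_mul hy]
  have : (↑π * I * ↑((theta2 (I * ↑y)).re ^ 4 * (theta4 (I * ↑y)).re ^ 4 /
      (theta3 (I * ↑y)).re ^ 4) * I : ℂ) = ((-(π * ((theta2 (I * y)).re ^ 4 *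
        (theta4 (I * y)).re ^ 4 / (theta3 (I * y)).re ^ 4)) : ℝ) : ℂ) := by
    push_cast
    linear_combination (↑π * (((theta2 (I * ↑y)).re : ℂ) ^ 4 * ((theta4 (I * ↑y)).re : ℂ) ^ 4 /
      ((theta3 (I * ↑y)).re : ℂ) ^ 4)) * I_sq
  rw [this, ofReal_re]

/-! ### Monotonicity, limits, and the bijection `i(0, ∞) → (0, 1)` -/

/-- **`y ↦ λ(iy)` is strictly decreasing on `(0, ∞)`** (its derivative `-π λ θ₄⁴` is negative).
[cite: Javanpeykar2014, §4.4] -/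
theorem strictAntiOn_modularLambda_I_mul_re :
    StrictAntiOn (fun t : ℝ ↦ (modularLambda (I * t)).re) (Set.Ioi 0) := by
  refine strictAntiOn_of_deriv_neg (convex_Ioi 0) ?_ ?_
  · exact fun t ht ↦ (hasDerivAt_modularLambda_I_mul_re ht).continuousAt.continuousWithinAt
  · intro t ht
    rw [interior_Ioi] at ht
    rw [(hasDerivAt_modularLambda_I_mul_re ht).deriv, neg_lt_zero]
    exact mul_pos pi_pos (thetaQuot_pos ht)

/-- `y ↦ λ(iy)` is continuous on `(0, ∞)`. [folklore] -/
theorem continuousOn_modularLambda_I_mul_re :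
    ContinuousOn (fun t : ℝ ↦ (modularLambda (I * t)).re) (Set.Ioi 0) :=
  fun _ ht ↦ (hasDerivAt_modularLambda_I_mul_re ht).continuousAt.continuousWithinAt

/-- **`λ(iy) → 0` as `y → ∞`** (`λ(i∞) = 0`). [cite: Javanpeykar2014, §4.4] -/
theorem tendsto_modularLambda_I_mul_re_atTop :
    Tendsto (fun t : ℝ ↦ (modularLambda (I * t)).re) atTop (𝓝 0) := by
  have hax : Tendsto (fun t : ℝ ↦ (I * t : ℂ)) atTop (comap im atTop) := by
    refine tendsto_comap_iff.mpr ?_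
    have : (im ∘ fun t : ℝ ↦ (I * t : ℂ)) = id := by funext t; simp
    rw [this]
    exact tendsto_id
  have h := (Complex.continuous_re.tendsto 0).comp (tendsto_modularLambda.comp hax)
  rw [Complex.zero_re] at h
  exact h

/-- **`λ(iy) → 1` as `y → 0⁺`** (`λ(0) = 1`; from `λ(i/y) = 1 - λ(iy)`). [cite: Javanpeykar2014, §4.4] -/
theorem tendsto_modularLambda_I_mul_re_nhdsGT_zero :
    Tendsto (fun t : ℝ ↦ (modularLambda (I * t)).re) (𝓝[>] 0) (𝓝 1) := by
  have hinv : Tendsto (fun t : ℝ ↦ 1 - (modularLambda (I * (t⁻¹ : ℝ))).re) (𝓝[>] 0)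
      (𝓝 (1 - 0)) :=
    (tendsto_modularLambda_I_mul_re_atTop.comp tendsto_inv_nhdsGT_zero).const_sub 1
  rw [sub_zero] at hinv
  refine hinv.congr' ?_
  filter_upwards [self_mem_nhdsWithin] with t (ht : 0 < t)
  have hS := modularLambda_neg_one_div (τ := I * t) (im_I_mul_pos ht)
  rw [neg_one_div_I_mul ht] at hS
  rw [hS, sub_re, one_re]
  ring

/-- `λ(i(0, ∞)) ⊇ (0, 1)` (intermediate value theorem between the two limits). [folklore] -/
theorem Ioo_subset_image_modularLambda_I_mul_re :
    Set.Ioo (0 : ℝ) 1 ⊆ (fun t : ℝ ↦ (modularLambda (I * t)).re) '' Set.Ioi 0 :=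
  IsPreconnected.intermediate_value_Ioo isPreconnected_Ioi (l₁ := atTop) (l₂ := 𝓝[>] 0)
    (tendsto_principal.mpr (eventually_gt_atTop 0)) inf_le_right
    continuousOn_modularLambda_I_mul_re tendsto_modularLambda_I_mul_re_atTop
    tendsto_modularLambda_I_mul_re_nhdsGT_zero

/-- **`λ` restricted to the imaginary axis is a bijection onto `(0, 1)`**: every `a ∈ (0, 1)` is
`λ(iy)` for a unique `y > 0` ("the restriction of `λ` to the imaginary axis `{iy : y > 0}` induces
a homeomorphism … to the open interval `(0,1)`"; the values `λ(iy)`, `y > 0`, do lie in `(0, 1)`: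
`modularLambda_I_mul`). [cite: Javanpeykar2014, §4.4] -/
theorem existsUnique_modularLambda_I_mul_eq {a : ℝ} (ha : a ∈ Set.Ioo (0 : ℝ) 1) :
    ∃! y : ℝ, 0 < y ∧ modularLambda (I * y) = a := by
  obtain ⟨y, hy, hfy⟩ := Ioo_subset_image_modularLambda_I_mul_re ha
  simp only [Set.mem_Ioi] at hy hfy
  refine ⟨y, ⟨hy, ?_⟩, ?_⟩
  · rw [(modularLambda_I_mul hy).1, ← hfy, modularLambda_I_mul_re hy]
  · rintro y' ⟨hy', hfy'⟩
    have : (modularLambda (I * y')).re = (modularLambda (I * y)).re := by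
      rw [hfy, hfy', ofReal_re]
    exact strictAntiOn_modularLambda_I_mul_re.injOn hy' hy this

/-! ### The series `Σ n aₙ qⁿ = q dλ/dq` -/

/-- **Termwise differentiation of `λ = Σ aₙ qⁿ` on the unit disc.** With
`aₙ = 16 · (qExpansion 2 (λ/16))ₙ` the `q`-expansion coefficients of `λ`
(`λ(τ) = Σ aₙ e^{πinτ}`, `hasSum_qExpansion_modularLambda_div_sixteen`) and `Λ` the cusp function
of `λ/16` (`λ(τ) = 16 Λ(e^{πiτ})`), for `|q| < 1` the series `Σ n aₙ qⁿ` converges to `16 q Λ'(q)`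
("`q dλ/dq`"). [folklore] -/
theorem hasSum_natCast_mul_coeff_mul_pow {q : ℂ} (hq : ‖q‖ < 1) :
    HasSum (fun n : ℕ ↦ (n : ℂ) *
        (16 * (UpperHalfPlane.qExpansion 2
          (fun τ : UpperHalfPlane ↦ modularLambda τ / 16)).coeff n) * q ^ n)
      (16 * q * deriv (UpperHalfPlane.cuspFunction 2
        (fun τ : UpperHalfPlane ↦ modularLambda τ / 16)) q) := by
  set c : ℕ → ℂ := fun n ↦
    (UpperHalfPlane.qExpansion 2 (fun τ : UpperHalfPlane ↦ modularLambda τ / 16)).coeff n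
  set Λ := UpperHalfPlane.cuspFunction 2 (fun τ : UpperHalfPlane ↦ modularLambda τ / 16)
  have han : AnalyticAt ℂ Λ 0 :=
    analyticAt_cuspFunction_two (g := fun z ↦ modularLambda z / 16)
      (fun z _ ↦ by rw [modularLambda_add_two])
      (fun z hz ↦ (differentiableAt_modularLambda hz).div_const 16)
      (tendsto_modularLambda.div_const 16)
  have H : HasFPowerSeriesOnBall Λ (FormalMultilinearSeries.ofScalars ℂ c) 0 1 :=
    UpperHalfPlane.hasFPowerSeriesOnBall_cuspFunction two_pos han fun τ ↦ by
      simpa only [smul_eq_mul] using hasSum_qExpansion_modularLambda_div_sixteen τ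
  have hq' : q ∈ Metric.eball (0 : ℂ) 1 := by
    rw [← ENNReal.coe_one, Metric.eball_coe, NNReal.coe_one, mem_ball_zero_iff]
    exact hq
  -- the derivative series, evaluated at `1`
  have H2 := (ContinuousLinearMap.apply ℂ ℂ (1 : ℂ)).hasSum (H.fderiv.hasSum hq')
  simp only [ContinuousLinearMap.apply_apply, zero_add, fderiv_apply_one_eq_deriv] at H2
  have hterm : ∀ n : ℕ, ((FormalMultilinearSeries.ofScalars ℂ c).derivSeries n fun _ ↦ q) 1 =
      q ^ n * (((n : ℂ) + 1) * c (n + 1)) := by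
    intro n
    rw [FormalMultilinearSeries.apply_eq_pow_smul_coeff, FunLike.coe_smul,
      Pi.smul_apply, FormalMultilinearSeries.derivSeries_coeff_one,
      FormalMultilinearSeries.coeff_ofScalars, smul_eq_mul, nsmul_eq_mul, Nat.cast_add,
      Nat.cast_one]
  simp only [hterm] at H2
  have H3 : HasSum (fun n : ℕ ↦ ((n + 1 : ℕ) : ℂ) * (16 * c (n + 1)) * q ^ (n + 1))
      (16 * q * deriv Λ q) := by
    refine (H2.mul_left (16 * q)).congr_fun fun n ↦ ?_
    push_cast
    ring
  rw [← hasSum_nat_add_iff' 1]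
  simpa only [Finset.sum_range_one, Nat.cast_zero, zero_mul, sub_zero] using H3

/-- **`Σ n aₙ qⁿ = q dλ/dq = λ'(τ)/(πi)`** for `q = e^{πiτ}`, `Im τ > 0` (by the chain rule
`λ'(τ) = 16 Λ'(q) · πi q`, `deriv_modularLambda_eq_cuspFunction`; recall also
`λ'/(πi) = λ θ₄⁴`, `deriv_modularLambda_eq'`). This is the identity "`Σ n aₙ qⁿ = q dλ/dq`" of the
proof of [cite: Javanpeykar2014, Lemma 4.4.1]. -/
theorem hasSum_natCast_mul_coeff_mul_exp {τ : ℂ} (hτ : 0 < im τ) :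
    HasSum (fun n : ℕ ↦ (n : ℂ) *
        (16 * (UpperHalfPlane.qExpansion 2
          (fun τ : UpperHalfPlane ↦ modularLambda τ / 16)).coeff n) * cexp (π * I * τ) ^ n)
      (deriv modularLambda τ / (π * I)) := by
  have hq : ‖cexp (π * I * τ)‖ < 1 := by
    rw [← qParam_two]
    exact Function.Periodic.norm_qParam_lt_one two_pos hτ
  have h := hasSum_natCast_mul_coeff_mul_pow hq
  have hpi : (π : ℂ) * I ≠ 0 := mul_ne_zero (ofReal_ne_zero.mpr pi_ne_zero) I_ne_zero
  have he : cexp (π * I * τ) ≠ 0 := Complex.exp_ne_zero _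
  rw [deriv_modularLambda_eq_cuspFunction hτ]
  convert h using 1
  field_simp

/-- The same with the sum evaluated: `Σ' n aₙ e^{πinτ} = λ(τ) θ₄(τ)⁴` on `ℍ`. [folklore] -/
theorem tsum_natCast_mul_coeff_mul_exp {τ : ℂ} (hτ : 0 < im τ) :
    ∑' n : ℕ, (n : ℂ) *
        (16 * (UpperHalfPlane.qExpansion 2
          (fun τ : UpperHalfPlane ↦ modularLambda τ / 16)).coeff n) * cexp (π * I * τ) ^ n =
      modularLambda τ * theta4 τ ^ 4 := by
  rw [(hasSum_natCast_mul_coeff_mul_exp hτ).tsum_eq, deriv_modularLambda_eq' hτ]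
  have hpi : (π : ℂ) * I ≠ 0 := mul_ne_zero (ofReal_ne_zero.mpr pi_ne_zero) I_ne_zero
  field_simp

end ModularLambda

end Literature.NumberTheory.Automorphic

end
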